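import Literature.NumberTheory.EllipticCurves.PAdicOneVariableGaussSum
import Mathlib.Analysis.Normed.Ring.Ultra
import Mathlib.NumberTheory.Padics.PadicVal.Basic
import Mathlib.Algebra.Ring.GeomSum
import HarnessLib

/-!
# STUB-IDEAS sketch k2·g43 — `stub_heegnerIndexLowerAtTwo` (crux `PrintCf2.SplitBadTwoLowerHalfOfFacts`)

Seat `planner-sidea-stub_heegnerIndexLowerAtTwo-2-g43` (family 1: literature transfer with a typed
dictionary, ≥ 2 techniques).  NODE = STUB-PLAN v7.6 HARDEST (b), residue **R200′(b″)**: per-key valuation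
LOWER bounds of the three factors of the coset-value identity (4)
`12·(χ(σ_𝔞)⁻¹ − N𝔞)·∫χ̂⁻¹dμ = G(χ⁻¹)·Σ_g χ(g)·log j₂(g u)` — the unit-log COLUMN (S) and the SMOOTHING
factor (S⁻); the Gauss digit is closed (critic row 123).

What is kernel-checked here (all `theorem`s below are sorry-free):
* §1 **column norm lemma** (T1) — the NORM form of the tree engine
  `BoundedDistribution.mul_sum_mulChar_mul_μ_eq_gaussSum_mul` (de Shalit II.4.8 (19)–(21); cyclotomic
  twin: Lang, *Cyclotomic Fields II*, ch. 4 Meas 5, p. 86): `‖g(χ,ζ)·column‖ ≤ ‖p^{n+1}‖·D.bound`, hence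
  `‖Σ_j χ⁻¹(−j)·P(ζ^j − 1)‖ ≤ ‖p^{n+1}‖·C/‖g(χ,ζ)‖` for `D = D_P`, `‖[S^m]P‖ ≤ C`.  With k1-g40's
  `‖g‖ = 2^{−(n+1)/2}` this is `v₂(column) ≥ (n+1)/2` (tree level `p^{n+1}` = de Shalit level `n`), from the
  ONE-variable measure of the unit alone — independent of the two-variable `μ` (non-circular).
* §2 **twelfth-root linearity** (T2, de Shalit II.2.7 = Gillard–Robert; II.4.12 p. 69 l. 7): the column is
  linear in `log`, so `u = φ^{12}` gives `column(u) = 12·column(φ)` — the `‖12‖₂⁻¹ = 4` of (4) is repaid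
  exactly and no lattice constant moves (B14/B34-compliant: a degree-1 identity).
* §3 **smoothing digits at `p = 2`** (T3): (i) for `z` a `2`-power root of unity and `m` odd,
  `‖z − m‖ < 1` in any ultrametric field with `‖2‖ < 1` — at `p = 2` the smoothing factor
  `χ(σ_𝔞)⁻¹ − N𝔞` is NEVER a unit when `χ` has `2`-power order; (ii) for `z ≠ 1` of ODD order and `m` odd,
  `‖z − m‖ = 1` (no loss); (iii) the `±1` digits in `ℕ`-currency: `v₂(m − 1) = 1 ⟺ m ≡ 3 (4)`,
  `v₂(m + 1) = 1 ⟺ m ≡ 1 (4)` (the attainable minimum `s = 1` for `±1`-valued `χ`).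
* §4 the per-key assembly `‖∫‖ = ‖G⁻¹‖·‖column‖/(‖12‖·‖smooth‖)` and the resulting bound.

NOT proved here (and not claimed): BSD; the crux `SplitBadTwoLowerHalfOfFacts`; the stub
`stub_heegnerIndexLowerAtTwo`; the junction «`unitLogSum` = tame combination of Coleman columns»
(road B′: RCF ✓ row 110, INST₂-CORE open); any `v₂(∫ r·θ̂⁻¹dμ) ≥ M/2` with `M/2 > 0` (GLOBAL: Rubin 1992 /
BDP 2012 eq. (2), printed for `p` split and `p ∤ N_A` only).
-/

noncomputable section

open Finset

namespace Summit.BirchSwinnertonDyer.BirchSwinnertonDyer.Cruxes.SplitBadTwoLowerHalfOfFacts.ColumnBoundK2G43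

open Literature.NumberTheory.EllipticCurves

/-! ### §1. T1 — the column norm lemma (norm form of de Shalit II.4.8 (19)–(21)) -/

section Column

variable {p : ℕ} [Fact p.Prime]
variable {𝕜 : Type*} [NormedField 𝕜] [IsUltrametricDist 𝕜]

/-- **T1a.** For ANY bounded distribution `D` on `ℤ_p` and a primitive character `χ` mod `p^{n+1}` with
`‖χ‖ ≤ 1`: `‖g(χ,ζ) · Σ_{j<p^{n+1}} χ⁻¹(−j)·charSum D (n+1) (ζ^j)‖ ≤ ‖p^{n+1}‖ · D.bound`.
(Take norms in the tree engine; the left side is `‖p^{n+1} Σ_b χ(b) D(b + p^{n+1}ℤ_p)‖`.) -/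
theorem norm_gaussSum_mul_column_le (D : BoundedDistribution (ProfiniteTower.padicInt p) 𝕜) (n : ℕ)
    {ζ : 𝕜} (hζ : IsPrimitiveRoot ζ (p ^ (n + 1))) (χ : DirichletCharacter 𝕜 (p ^ (n + 1)))
    (hχ : χ.IsPrimitive) (hχ1 : ∀ b, ‖χ b‖ ≤ 1) :
    ‖(∑ b : ZMod (p ^ (n + 1)), χ b * ζ ^ b.val) *
        ∑ j ∈ range (p ^ (n + 1)), χ⁻¹ (-(j : ZMod (p ^ (n + 1)))) * D.charSum (n + 1) (ζ ^ j)‖ ≤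
      ‖((p ^ (n + 1) : ℕ) : 𝕜)‖ * D.bound := by
  rw [← D.mul_sum_mulChar_mul_μ_eq_gaussSum_mul n hζ χ hχ, norm_mul]
  refine mul_le_mul_of_nonneg_left ?_ (norm_nonneg _)
  refine IsUltrametricDist.norm_sum_le_of_forall_le_of_nonneg D.bound_nonneg fun b _ ↦ ?_
  rw [norm_mul]
  calc ‖χ b‖ * ‖D.μ (n + 1) b‖ ≤ 1 * D.bound :=
        mul_le_mul (hχ1 b) (D.norm_le _ _) (norm_nonneg _) zero_le_one
    _ = D.bound := one_mul _

/-- **T1b.** Dividing by the Gauss sum: `‖column(D)‖ ≤ ‖p^{n+1}‖ · D.bound / ‖g(χ,ζ)‖` (`g ≠ 0`). -/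
theorem norm_column_le_div (D : BoundedDistribution (ProfiniteTower.padicInt p) 𝕜) (n : ℕ)
    {ζ : 𝕜} (hζ : IsPrimitiveRoot ζ (p ^ (n + 1))) (χ : DirichletCharacter 𝕜 (p ^ (n + 1)))
    (hχ : χ.IsPrimitive) (hχ1 : ∀ b, ‖χ b‖ ≤ 1)
    (hg : (∑ b : ZMod (p ^ (n + 1)), χ b * ζ ^ b.val) ≠ 0) :
    ‖∑ j ∈ range (p ^ (n + 1)), χ⁻¹ (-(j : ZMod (p ^ (n + 1)))) * D.charSum (n + 1) (ζ ^ j)‖ ≤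
      ‖((p ^ (n + 1) : ℕ) : 𝕜)‖ * D.bound / ‖∑ b : ZMod (p ^ (n + 1)), χ b * ζ ^ b.val‖ := by
  have hgpos : 0 < ‖∑ b : ZMod (p ^ (n + 1)), χ b * ζ ^ b.val‖ := norm_pos_iff.mpr hg
  rw [le_div_iff₀ hgpos, mul_comm, ← norm_mul]
  exact norm_gaussSum_mul_column_le D n hζ χ hχ hχ1

variable [NormedAlgebra ℚ_[p] 𝕜] [CompleteSpace 𝕜]

/-- **T1c (power-series form).** For `D = D_P` with `‖[S^m]P‖ ≤ C`:
`‖Σ_{j<p^{n+1}} χ⁻¹(−j) · Σ_m [S^m]P (ζ^j − 1)^m‖ ≤ ‖p^{n+1}‖ · C / ‖g(χ,ζ)‖` — the valuation LOWER bound of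
the Coleman column from the coefficient bound of the series ALONE. -/
theorem norm_column_invAmice₁_le {P : PowerSeries 𝕜} {C : ℝ} (hC : ∀ m, ‖PowerSeries.coeff m P‖ ≤ C)
    (n : ℕ) {ζ : 𝕜} (hζ : IsPrimitiveRoot ζ (p ^ (n + 1))) (χ : DirichletCharacter 𝕜 (p ^ (n + 1)))
    (hχ : χ.IsPrimitive) (hχ1 : ∀ b, ‖χ b‖ ≤ 1)
    (hg : (∑ b : ZMod (p ^ (n + 1)), χ b * ζ ^ b.val) ≠ 0) :
    ‖∑ j ∈ range (p ^ (n + 1)), χ⁻¹ (-(j : ZMod (p ^ (n + 1)))) *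
        ∑' m : ℕ, PowerSeries.coeff m P * (ζ ^ j - 1) ^ m‖ ≤
      ‖((p ^ (n + 1) : ℕ) : 𝕜)‖ * C / ‖∑ b : ZMod (p ^ (n + 1)), χ b * ζ ^ b.val‖ := by
  have hε : ∀ j : ℕ, (ζ ^ j) ^ p ^ (n + 1) = 1 := fun j ↦ by
    rw [← pow_mul, mul_comm, pow_mul, hζ.pow_eq_one, one_pow]
  have h := norm_column_le_div (invAmice₁ p P hC) n hζ χ hχ hχ1 hg
  simp_rw [charSum_invAmice₁_eq_tsum hC (n + 1) (hε _), invAmice₁_bound] at h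
  exact h

/-- **T1d (numerical shape).** If `‖g(χ,ζ)‖ = r > 0` and `‖p^{n+1}‖ = q` then `‖column‖ ≤ q·C/r`; at `p = 2`,
`q = 2^{−(n+1)}` and (k1-g40, exact conductor `4` or `8`) `r = 2^{−(n+1)/2}`, so `‖column‖ ≤ C·2^{−(n+1)/2}`. -/
theorem norm_column_invAmice₁_le_of_eq {P : PowerSeries 𝕜} {C : ℝ} (hC : ∀ m, ‖PowerSeries.coeff m P‖ ≤ C)
    (n : ℕ) {ζ : 𝕜} (hζ : IsPrimitiveRoot ζ (p ^ (n + 1))) (χ : DirichletCharacter 𝕜 (p ^ (n + 1)))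
    (hχ : χ.IsPrimitive) (hχ1 : ∀ b, ‖χ b‖ ≤ 1) {r q : ℝ} (hr : 0 < r)
    (hgr : ‖∑ b : ZMod (p ^ (n + 1)), χ b * ζ ^ b.val‖ = r) (hq : ‖((p ^ (n + 1) : ℕ) : 𝕜)‖ = q) :
    ‖∑ j ∈ range (p ^ (n + 1)), χ⁻¹ (-(j : ZMod (p ^ (n + 1)))) *
        ∑' m : ℕ, PowerSeries.coeff m P * (ζ ^ j - 1) ^ m‖ ≤ q * C / r := by
  have hg : (∑ b : ZMod (p ^ (n + 1)), χ b * ζ ^ b.val) ≠ 0 := by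
    rw [← norm_pos_iff, hgr]; exact hr
  have h := norm_column_invAmice₁_le hC n hζ χ hχ hχ1 hg
  rwa [hgr, hq] at h

end Column

/-! ### §2. T2 — twelfth-root linearity (de Shalit II.2.7, Gillard–Robert) -/

section TwelfthRoot

/-- **T2a.** A Galois-weighted log column is linear in the unit: `Σ_g c(g)·ℓ(g·u^m) = m · Σ_g c(g)·ℓ(g·u)`
for any `ℓ` with `ℓ(x^m) = m·ℓ(x)` and any action by monoid homs (the shape of `unitLogSum`). -/
theorem sum_mul_log_act_pow {G M A : Type*} [Fintype G] [Monoid M] [CommRing A]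
    (c : G → A) (ℓ : M → A) (act : G → M →* M) (hℓ : ∀ (x : M) (m : ℕ), ℓ (x ^ m) = (m : A) * ℓ x)
    (u : M) (m : ℕ) :
    ∑ g, c g * ℓ (act g (u ^ m)) = (m : A) * ∑ g, c g * ℓ (act g u) := by
  simp_rw [map_pow, hℓ, Finset.mul_sum]
  exact Finset.sum_congr rfl fun g _ ↦ by ring

/-- **T2b.** Hence `‖column(u^m)‖ = ‖m‖ · ‖column(u)‖`: for `m = 12` at `p = 2` the column of the Θ-unit
`u = φ^{12}` (II.2.7: `Θ(v; L, 𝔞)` is a `12 w_𝔣`-th power in `K(𝔣)^×`, `(𝔞, 6𝔣) = 1`; `w_𝔣 = 1` on the frame)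
is `‖12‖₂ = ¼` times the column of `φ` — exactly the `‖12‖⁻¹` of identity (4). -/
theorem norm_sum_mul_log_act_pow {G M A : Type*} [Fintype G] [Monoid M] [NormedField A]
    (c : G → A) (ℓ : M → A) (act : G → M →* M) (hℓ : ∀ (x : M) (m : ℕ), ℓ (x ^ m) = (m : A) * ℓ x)
    (u : M) (m : ℕ) :
    ‖∑ g, c g * ℓ (act g (u ^ m))‖ = ‖(m : A)‖ * ‖∑ g, c g * ℓ (act g u)‖ := by
  rw [sum_mul_log_act_pow c ℓ act hℓ u m, norm_mul]

/-- **T2 fact shape** (de Shalit II.2.7 Proposition, citing Gillard–Robert [Gi-R] Prop. A-2; p. 48):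
every element of `S` (the Θ-units `Θ(v; 𝔣vⁿ, 𝔞)`, `(𝔞, 6𝔣v) = 1`) is a `12`-th power in the field. -/
def TwelfthPowerShape (F : Type*) [Field F] (S : Set F) : Prop := ∀ u ∈ S, ∃ φ : F, u = φ ^ 12

end TwelfthRoot

/-! ### §3. T3 — the smoothing digit `v₂(χ(σ_𝔞)⁻¹ − N𝔞)` at `p = 2` -/

section Smoothing

variable {𝕜 : Type*} [NormedField 𝕜] [IsUltrametricDist 𝕜]

/-- Ultrametric inequality for differences. -/
theorem norm_sub_le_max' (x y : 𝕜) : ‖x - y‖ ≤ max ‖x‖ ‖y‖ := by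
  rw [sub_eq_add_neg, ← norm_neg y]
  exact IsUltrametricDist.norm_add_le_max x (-y)

/-- Isosceles triangles, difference form. -/
theorem norm_sub_eq_max_of_norm_ne_norm' {x y : 𝕜} (h : ‖x‖ ≠ ‖y‖) : ‖x - y‖ = max ‖x‖ ‖y‖ := by
  have h' : ‖x‖ ≠ ‖-y‖ := by rwa [norm_neg]
  rw [sub_eq_add_neg, IsUltrametricDist.norm_add_eq_max_of_norm_ne_norm h', norm_neg]

/-- `‖z² − 1‖ < 1 ⇒ ‖z − 1‖ < 1` when `‖2‖ < 1` (residue characteristic `2`: `z + 1 = (z − 1) + 2`). -/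
theorem norm_sub_one_lt_one_of_sq (h2 : ‖(2 : 𝕜)‖ < 1) {z : 𝕜} (hz : ‖z ^ 2 - 1‖ < 1) :
    ‖z - 1‖ < 1 := by
  by_contra hcon
  push Not at hcon
  have hfac : z ^ 2 - 1 = (z - 1) * ((z - 1) + 2) := by ring
  have hne : ‖z - 1‖ ≠ ‖(2 : 𝕜)‖ := by
    intro h; rw [h] at hcon; exact absurd h2 (not_lt.mpr hcon)
  have hplus : ‖(z - 1) + 2‖ = max ‖z - 1‖ ‖(2 : 𝕜)‖ :=
    IsUltrametricDist.norm_add_eq_max_of_norm_ne_norm hne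
  have hmax : max ‖z - 1‖ ‖(2 : 𝕜)‖ = ‖z - 1‖ := max_eq_left (h2.le.trans hcon)
  rw [hfac, norm_mul, hplus, hmax] at hz
  have : (1 : ℝ) ≤ ‖z - 1‖ * ‖z - 1‖ := by nlinarith
  linarith

/-- **T3(i).** A `2`-power root of unity is a principal unit when `‖2‖ < 1`: `z^{2^k} = 1 ⇒ ‖z − 1‖ < 1`. -/
theorem norm_sub_one_lt_one_of_pow_two_pow (h2 : ‖(2 : 𝕜)‖ < 1) :
    ∀ (k : ℕ) {z : 𝕜}, z ^ 2 ^ k = 1 → ‖z - 1‖ < 1 := by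
  intro k
  induction k with
  | zero => intro z hz; simp [pow_zero, pow_one] at hz; simp [hz]
  | succ k ih =>
      intro z hz
      have hz2 : (z ^ 2) ^ 2 ^ k = 1 := by rw [← pow_mul, ← pow_succ']; exact hz
      have h := ih hz2
      exact norm_sub_one_lt_one_of_sq h2 h

/-- Odd naturals are `≡ 1` to first order: `‖(m : 𝕜) − 1‖ < 1` for odd `m` when `‖2‖ < 1`. -/
theorem norm_natCast_sub_one_lt_one (h2 : ‖(2 : 𝕜)‖ < 1) {m : ℕ} (hm : Odd m) :
    ‖(m : 𝕜) - 1‖ < 1 := by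
  obtain ⟨j, rfl⟩ := hm
  have : ((2 * j + 1 : ℕ) : 𝕜) - 1 = 2 * (j : 𝕜) := by push_cast; ring
  rw [this, norm_mul]
  calc ‖(2 : 𝕜)‖ * ‖(j : 𝕜)‖ ≤ ‖(2 : 𝕜)‖ * 1 :=
        mul_le_mul_of_nonneg_left (IsUltrametricDist.norm_natCast_le_one 𝕜 j) (norm_nonneg _)
    _ < 1 := by rw [mul_one]; exact h2

/-- **T3(i) — the smoothing factor is never a unit at `p = 2` for `2`-power-order values:**
`z^{2^k} = 1`, `m` odd ⇒ `‖z − m‖ < 1`.  (All `2`-power roots of unity and all odd `N𝔞` are `≡ 1 mod 𝔪`.) -/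
theorem norm_rootTwoPow_sub_odd_lt_one (h2 : ‖(2 : 𝕜)‖ < 1) {k : ℕ} {z : 𝕜} (hz : z ^ 2 ^ k = 1)
    {m : ℕ} (hm : Odd m) : ‖z - (m : 𝕜)‖ < 1 := by
  have h1 := norm_sub_one_lt_one_of_pow_two_pow h2 k hz
  have h3 := norm_natCast_sub_one_lt_one h2 hm
  have : z - (m : 𝕜) = (z - 1) - ((m : 𝕜) - 1) := by ring
  rw [this]
  calc ‖(z - 1) - ((m : 𝕜) - 1)‖ ≤ max ‖z - 1‖ ‖(m : 𝕜) - 1‖ :=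
        norm_sub_le_max' _ _
    _ < 1 := max_lt h1 h3

/-- `‖(k : 𝕜)‖ = 1` for odd `k` when `‖2‖ < 1`. -/
theorem norm_natCast_eq_one_of_odd (h2 : ‖(2 : 𝕜)‖ < 1) {k : ℕ} (hk : Odd k) : ‖(k : 𝕜)‖ = 1 := by
  have hle : ‖(k : 𝕜)‖ ≤ 1 := IsUltrametricDist.norm_natCast_le_one 𝕜 k
  have hlt := norm_natCast_sub_one_lt_one h2 hk
  by_contra hne
  have hlt' : ‖(k : 𝕜)‖ < 1 := lt_of_le_of_ne hle hne
  have : ‖(1 : 𝕜)‖ < 1 := by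
    have h1 : (1 : 𝕜) = (k : 𝕜) - ((k : 𝕜) - 1) := by ring
    rw [h1]
    calc ‖(k : 𝕜) - ((k : 𝕜) - 1)‖ ≤ max ‖(k : 𝕜)‖ ‖(k : 𝕜) - 1‖ :=
          norm_sub_le_max' _ _
      _ < 1 := max_lt hlt' hlt
  simp at this

/-- `‖Σ_{i<k} z^i − k‖ ≤ ‖z − 1‖` for `‖z‖ ≤ 1` (each `z^i − 1 = (z − 1)·Σ_{j<i} z^j`). -/
theorem norm_geom_sum_sub_card_le {z : 𝕜} (hz : ‖z‖ ≤ 1) (k : ℕ) :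
    ‖(∑ i ∈ range k, z ^ i) - (k : 𝕜)‖ ≤ ‖z - 1‖ := by
  have hrew : (∑ i ∈ range k, z ^ i) - (k : 𝕜) = ∑ i ∈ range k, (z ^ i - 1) := by
    rw [Finset.sum_sub_distrib]; simp
  rw [hrew]
  refine IsUltrametricDist.norm_sum_le_of_forall_le_of_nonneg (norm_nonneg _) fun i _ ↦ ?_
  have hgeom : z ^ i - 1 = (∑ j ∈ range i, z ^ j) * (z - 1) := (geom_sum_mul z i).symm
  rw [hgeom, norm_mul]
  calc ‖∑ j ∈ range i, z ^ j‖ * ‖z - 1‖ ≤ 1 * ‖z - 1‖ := by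
        refine mul_le_mul_of_nonneg_right ?_ (norm_nonneg _)
        refine IsUltrametricDist.norm_sum_le_of_forall_le_of_nonneg zero_le_one fun j _ ↦ ?_
        rw [norm_pow]; exact pow_le_one₀ (norm_nonneg _) hz
    _ = ‖z - 1‖ := one_mul _

/-- **T3(ii) — no loss for odd-order values:** `z^k = 1`, `k` odd, `z ≠ 1` ⇒ `‖z − 1‖ = 1` (when `‖2‖ < 1`). -/
theorem norm_sub_one_eq_one_of_pow_eq_one_odd (h2 : ‖(2 : 𝕜)‖ < 1) {k : ℕ} (hk : Odd k) {z : 𝕜}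
    (hz : z ^ k = 1) (hz1 : z ≠ 1) : ‖z - 1‖ = 1 := by
  have hk0 : 0 < k := hk.pos
  have hnz : ‖z‖ = 1 := by
    have h := congrArg norm hz
    rw [norm_pow, norm_one] at h
    exact (pow_eq_one_iff_of_nonneg (norm_nonneg z) hk0.ne').mp h
  have hle : ‖z - 1‖ ≤ 1 := by
    calc ‖z - 1‖ ≤ max ‖z‖ ‖(1 : 𝕜)‖ := norm_sub_le_max' _ _
      _ = 1 := by rw [hnz, norm_one, max_self]
  refine le_antisymm hle ?_
  by_contra hcon
  push Not at hcon
  -- the geometric sum vanishes since `z ≠ 1` and `z^k = 1`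
  have hgs : (∑ i ∈ range k, z ^ i) * (z - 1) = 0 := by rw [geom_sum_mul, hz, sub_self]
  have hsum0 : ∑ i ∈ range k, z ^ i = 0 := by
    rcases mul_eq_zero.mp hgs with h | h
    · exact h
    · exact absurd (sub_eq_zero.mp h) hz1
  -- but it is `≡ k`, a unit
  have hk1 : ‖(k : 𝕜)‖ = 1 := norm_natCast_eq_one_of_odd h2 hk
  have hdiff := norm_geom_sum_sub_card_le hnz.le k
  rw [hsum0, zero_sub, norm_neg, hk1] at hdiff
  linarith

/-- **T3(ii′).** Hence for `z ≠ 1` of odd order and `m` odd: `‖z − m‖ = 1` — choosing `𝔞` with `χ(σ_𝔞)` of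
non-`2`-power order makes the smoothing factor a UNIT (`s = 0`). -/
theorem norm_rootOdd_sub_odd_eq_one (h2 : ‖(2 : 𝕜)‖ < 1) {k : ℕ} (hk : Odd k) {z : 𝕜} (hz : z ^ k = 1)
    (hz1 : z ≠ 1) {m : ℕ} (hm : Odd m) : ‖z - (m : 𝕜)‖ = 1 := by
  have h1 := norm_sub_one_eq_one_of_pow_eq_one_odd h2 hk hz hz1
  have h3 := norm_natCast_sub_one_lt_one h2 hm
  have hrew : z - (m : 𝕜) = (z - 1) - ((m : 𝕜) - 1) := by ring
  have hne : ‖z - 1‖ ≠ ‖(m : 𝕜) - 1‖ := by rw [h1]; exact (ne_of_lt h3).symm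
  rw [hrew, norm_sub_eq_max_of_norm_ne_norm' hne, h1]
  exact max_eq_left h3.le

/-- **T3(iii) — the `±1` digits in the consumer's `padicValNat 2` currency.** `m ≡ 3 (4) ⇒ v₂(m − 1) = 1`
(`χ(σ_𝔞) = +1`, `N𝔞 ≡ 3 mod 4`). -/
theorem padicValNat_two_sub_one_of_mod_four_eq_three {m : ℕ} (hm : m % 4 = 3) :
    padicValNat 2 (m - 1) = 1 := by
  have h : m - 1 = 2 * (2 * (m / 4) + 1) := by omega
  rw [h, padicValNat.mul (by norm_num) (by omega), padicValNat.self (by norm_num),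
    padicValNat.eq_zero_of_not_dvd (by omega)]

/-- `m ≡ 1 (4) ⇒ v₂(m + 1) = 1` (`χ(σ_𝔞) = −1`, `N𝔞 ≡ 1 mod 4`). -/
theorem padicValNat_two_add_one_of_mod_four_eq_one {m : ℕ} (hm : m % 4 = 1) :
    padicValNat 2 (m + 1) = 1 := by
  have h : m + 1 = 2 * (2 * (m / 4) + 1) := by omega
  rw [h, padicValNat.mul (by norm_num) (by omega), padicValNat.self (by norm_num),
    padicValNat.eq_zero_of_not_dvd (by omega)]

/-- … and the other residues cost at least two: `m ≡ 1 (4) ⇒ 2 ≤ v₂(m − 1)` (`m > 1`). -/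
theorem two_le_padicValNat_two_sub_one_of_mod_four_eq_one {m : ℕ} (hm : m % 4 = 1) (hm1 : 1 < m) :
    2 ≤ padicValNat 2 (m - 1) := by
  have h4 : 4 ∣ m - 1 := by omega
  have hne : m - 1 ≠ 0 := by omega
  have := (padicValNat_dvd_iff_le hne).mp (by simpa using h4 : 2 ^ 2 ∣ m - 1)
  exact this

/-- `m ≡ 3 (4) ⇒ 2 ≤ v₂(m + 1)`. -/
theorem two_le_padicValNat_two_add_one_of_mod_four_eq_three {m : ℕ} (hm : m % 4 = 3) :
    2 ≤ padicValNat 2 (m + 1) := by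
  have h4 : 4 ∣ m + 1 := by omega
  have := (padicValNat_dvd_iff_le (by omega : m + 1 ≠ 0)).mp (by simpa using h4 : 2 ^ 2 ∣ m + 1)
  exact this

/-- **T3 fact shape** (choice of the auxiliary ideal; Chebotarev for the ray class field, tree
`Literature.NumberTheory.LFunctions.ChebotarevDensityNumberField`): every class of the finite abelian
group `G` is hit by an admissible ideal, with either residue of `N𝔞 mod 4` when `G` does not see it. -/
def SmoothingChoiceShape (G : Type*) [CommGroup G] (art : ℕ → Option G) : Prop :=
  ∀ g : G, ∀ r ∈ ({1, 3} : Finset ℕ), ∃ N : ℕ, N % 4 = r ∧ art N = some g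

end Smoothing

/-! ### §4. Per-key assembly: what the three factor bounds give for `∫ χ̂⁻¹ dμ` -/

section Assembly

variable {𝕜 : Type*} [NormedField 𝕜]

/-- **(4) read in norms.** From `twelve·s·I = Ginv·U` with `twelve·s ≠ 0`:
`‖I‖ = ‖Ginv‖·‖U‖/(‖twelve‖·‖s‖)`. -/
theorem norm_integral_eq_of_identity {twelve s I Ginv U : 𝕜} (h : twelve * s * I = Ginv * U)
    (h12 : twelve ≠ 0) (hs : s ≠ 0) : ‖I‖ = ‖Ginv‖ * ‖U‖ / (‖twelve‖ * ‖s‖) := by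
  have hts : twelve * s ≠ 0 := mul_ne_zero h12 hs
  have hI : I = Ginv * U / (twelve * s) := by
    field_simp
    linear_combination h
  rw [hI, norm_div, norm_mul, norm_mul]

/-- **Per-key LOWER bound from the three factors (B75 shape).** If `‖Ginv‖ ≤ γ` (Gauss digit, k1-g40:
`γ = 2^{n/2}`), `‖U‖ ≤ ‖twelve‖·β` (column: T1 + T2, `β = 2^{−n/2}` for the primitive-lattice unit) and
`σ ≤ ‖s‖` (smoothing, T3: `σ = 2^{−s_min}`), then `‖I‖ ≤ γ·β/σ` — i.e. `v₂(∫χ̂⁻¹dμ) ≥ −s_min(χ)`: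
the per-factor route reproduces integrality EXACTLY up to the smoothing digit, never beyond. -/
theorem norm_integral_le_of_factor_bounds {twelve s I Ginv U : 𝕜} (h : twelve * s * I = Ginv * U)
    (h12 : twelve ≠ 0) {γ β σ : ℝ} (hγ : ‖Ginv‖ ≤ γ) (hβ0 : 0 ≤ β) (hU : ‖U‖ ≤ ‖twelve‖ * β)
    (hσ : 0 < σ) (hsσ : σ ≤ ‖s‖) : ‖I‖ ≤ γ * β / σ := by
  have hs : s ≠ 0 := by
    intro h0; rw [h0, norm_zero] at hsσ; exact absurd hsσ (not_le.mpr hσ)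
  have h12pos : 0 < ‖twelve‖ := norm_pos_iff.mpr h12
  have hγ0 : 0 ≤ γ := (norm_nonneg _).trans hγ
  rw [norm_integral_eq_of_identity h h12 hs, div_le_div_iff₀ (mul_pos h12pos (norm_pos_iff.mpr hs)) hσ]
  calc ‖Ginv‖ * ‖U‖ * σ ≤ γ * (‖twelve‖ * β) * ‖s‖ := by
        gcongr
    _ = γ * β * (‖twelve‖ * ‖s‖) := by ring

end Assembly

end Summit.BirchSwinnertonDyer.BirchSwinnertonDyer.Cruxes.SplitBadTwoLowerHalfOfFacts.ColumnBoundK2G43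

end
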